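import Mathlib
import HarnessLib

/-!
# Bump non-vanishing (route `IrreducibilityBySelfDuality`, input `PairLBoundaryJS`)

Helper for item stmt-Langlands-13622 (Jacquet–Shalika boundary theorem for the partial
Rankin–Selberg product `L^S = I / Ψ`, global integral over local integrals), line "Sketch":
at a given point `s₀` one needs ONE local datum whose local integral `Ψ(s₀) = ∫ φ · G dν` is
non-zero; it is obtained by taking `φ` a bump (the indicator of a small set of positive finite
measure) concentrated near a point `x₀` where the continuous factor `G` does not vanish.

This file is that generic "bump non-vanishing" fact of measure theory: if `g` is continuous at
`x₀` with `g x₀ ≠ 0`, then on the neighbourhood `U = g ⁻¹' B(g x₀, ‖g x₀‖ / 2)` of `x₀` the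
values of `g` stay within `‖g x₀‖ / 2` of `g x₀`, so for every measurable `B ⊆ U` of finite
positive measure `‖∫_B g - μ(B) • g x₀‖ ≤ μ(B) ‖g x₀‖ / 2 < ‖μ(B) • g x₀‖`, whence
`∫_B g ∂μ ≠ 0`.
-/

noncomputable section

-- `Summit.Langlands.Langlands.…` (summit = sub-problem name, D-0017 layout) trips `dupNamespace`
set_option linter.dupNamespace false

open MeasureTheory Filter Topology

namespace Summit.Langlands.Langlands.Theorems

/-- **Bump non-vanishing.** If `g : X → ℂ` is a.e. strongly measurable, continuous at `x₀` and
`g x₀ ≠ 0`, then there is a neighbourhood `U` of `x₀` such that the integral of `g` over every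
measurable subset `B ⊆ U` of finite positive measure is non-zero. (Take
`U = g ⁻¹' B(g x₀, ‖g x₀‖ / 2)`: on `B` one has `‖g - g x₀‖ ≤ ‖g x₀‖ / 2`, so
`‖∫_B g - μ(B) • g x₀‖ ≤ μ(B) ‖g x₀‖ / 2 < μ(B) ‖g x₀‖`.) -/
theorem exists_nhds_setIntegral_ne_zero {X : Type*} [TopologicalSpace X] [MeasurableSpace X]
    (μ : Measure X) {g : X → ℂ} {x₀ : X} (hg : ContinuousAt g x₀) (h0 : g x₀ ≠ 0)
    (hmeas : AEStronglyMeasurable g μ) :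
    ∃ U ∈ 𝓝 x₀, ∀ B ⊆ U, MeasurableSet B → μ B ≠ 0 → μ B ≠ ⊤ → ∫ x in B, g x ∂μ ≠ 0 := by
  have hn : 0 < ‖g x₀‖ := norm_pos_iff.mpr h0
  have hr : (0 : ℝ) < ‖g x₀‖ / 2 := half_pos hn
  refine ⟨g ⁻¹' Metric.ball (g x₀) (‖g x₀‖ / 2),
    hg.preimage_mem_nhds (Metric.ball_mem_nhds _ hr), ?_⟩
  intro B hB hBm hB0 hBtop
  -- on `B` the values of `g` stay within `‖g x₀‖ / 2` of `g x₀`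
  have hbound : ∀ x ∈ B, ‖g x - g x₀‖ ≤ ‖g x₀‖ / 2 := fun x hx => by
    have hx' : g x ∈ Metric.ball (g x₀) (‖g x₀‖ / 2) := hB hx
    rw [Metric.mem_ball, dist_eq_norm] at hx'
    exact hx'.le
  -- hence `g` is bounded on the finite-measure set `B`, so integrable there
  have hint : IntegrableOn g B μ := by
    refine Measure.integrableOn_of_bounded (M := ‖g x₀‖ / 2 + ‖g x₀‖) hBtop hmeas ?_
    refine (ae_restrict_iff' hBm).2 (Eventually.of_forall fun x hx => ?_)
    calc ‖g x‖ = ‖(g x - g x₀) + g x₀‖ := by rw [sub_add_cancel]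
      _ ≤ ‖g x - g x₀‖ + ‖g x₀‖ := norm_add_le _ _
      _ ≤ ‖g x₀‖ / 2 + ‖g x₀‖ := by linarith [hbound x hx]
  have hpos : 0 < μ.real B := ENNReal.toReal_pos hB0 hBtop
  -- the deviation of `∫_B g` from `μ(B) • g x₀` is at most `μ(B) ‖g x₀‖ / 2`
  have hest : ‖∫ x in B, (g x - g x₀) ∂μ‖ ≤ ‖g x₀‖ / 2 * μ.real B :=
    norm_setIntegral_le_of_norm_le_const hBtop.lt_top hbound
  have hsub : ∫ x in B, (g x - g x₀) ∂μ = ∫ x in B, g x ∂μ - μ.real B • g x₀ := by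
    rw [integral_sub hint.integrable (integrableOn_const hBtop).integrable, setIntegral_const]
  intro hzero
  rw [hsub, hzero, zero_sub, norm_neg, norm_smul, Real.norm_of_nonneg hpos.le] at hest
  -- `μ(B) ‖g x₀‖ ≤ μ(B) ‖g x₀‖ / 2` contradicts `μ(B) ‖g x₀‖ > 0`
  linarith [mul_pos hpos hn]

end Summit.Langlands.Langlands.Theorems

end
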